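import Summits.NavierStokesRegularity.NavierStokesRegularity.Theorems.TypeICertificateLadderTargetRssCompactness
import Summits.NavierStokesRegularity.NavierStokesRegularity.Theorems.TypeICertificateLadderTargetRdssCompactnessLimit
import HarnessLib

/-!
# Crux `Target` (stmt-NavierStokesRegularity-1217), line `killing-twisted-bernoulli-solitons`,
  stub B5b: ROTATED DISCRETELY self-similar Liouville near `(α₀, λ = 1)` for every GOOD speed —
  Pineau–Vicol 2026, Theorem 1.7 (i) by compactness, and its extension to all good `α₀`

Support file (theorems only, `--supports stmt-NavierStokesRegularity-1217`), registered sub-goal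
`rdssCompact_liouville_near` of the c2 lead.

Notation as in `TypeICertificateLadderTargetRssCompactness.lean`: `L(C₀, α₀)` = the Type-I
(constant `C₀`) RSS Liouville property of Pineau–Vicol's class at the speed `α₀`.

* `rdssCompact_liouville_near` — **RDSS Liouville near `(α₀, 1)` from RSS Liouville at `α₀`.**
  For `C₀ > 0` and every speed `α₀` with `L(C₀, α₀)` there are `δ > 0` and `c₁ > 1` such that every
  classical solution on `[−1, 0)` with the Type-I bound (constant `C₀`) which is backwards
  ROTATED DISCRETELY self-similar (Pineau–Vicol (1.13)) with speed `α`, `|α − α₀| < δ`, factor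
  `c ∈ (1, c₁)` and a `C²` `2 log c`-periodic profile, has vanishing profile on `ℝ³ × [0, 2 log c]`.
  Proof: Chae–Wolf's indirect compactness argument — counterexamples with `α_n → α₀`, `c_n → 1`
  extend backwards (footnote 21, `exists_isClassicalNSSolutionOn_Iio_of_isRotatedDSS`) with the same
  constant (Remark 1.2 / Lemma 7.1), a subsequence has a locally uniform limit which is
  RSS-symmetric with speed `α₀`, Type-I, non-trivial at `t = −1` (`rdssCompact_exists_limit`, the
  registered extraction stub: the factors `c_n^{k_n} → μ` for every `μ ≥ 1`, the angles
  `2α_n log c_n^{k_n} → 2α₀ log μ`), and that limit is a classical Pineau–Vicol-class RSS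
  counterexample at `(C₀, α₀)` (`rssCompact_not_liouvilleAt_of_limit`), contradicting `L(C₀, α₀)`.
* `rdssCompact_pineauVicol_thm17_small` — the case `α₀ = 0` (good by Theorem 1.4): EXACTLY the
  first conjunct of the named fact `Literature.Analysis.FluidPDE.pineauVicol2026_rdss_liouville`
  (Pineau–Vicol Thm. 1.7 (i): `|α| ≤ α₁`, `1 < c < c₁` ⇒ `U ≡ 0`), whose `_holds` discharge is not
  in the tree (its printed proof, §7, needs the principal-eigenpair theory of §5); here by
  compactness, as the paper notes for the DSS case `α = 0` (Thm. 1.6 = Chae–Wolf Thm. 1.3).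
* `rdssCompact_liouville_near_of_extreme` — near every speed in the two regimes of Theorem 1.4
  (`|α₀| < α₁` or `|α₀| > α₂`), RDSS Liouville holds for factors near `1`.

Honest scope: the second conjunct of Thm. 1.7 (`|α| ≥ α₂` with `c < c₂^{1/(1+α²)}`, uniform as
`|α| → ∞`) needs an extraction along `|α_n| → ∞` with arithmetic tuning of the angles and is NOT
proved here; B5b stays OPEN.

## References

* B. Pineau, V. Vicol, arXiv:2607.09619 (2026): §1.4 (1.13)–(1.14), **Theorem 1.7** (p. 7),
  Theorem 1.6, Remark 1.2, Lemma 7.1, footnote 21, p. 6 (compactness). [PineauVicol2026]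
* D. Chae, J. Wolf, Comm. PDE 42 (2017) 1359–1374 = arXiv:1610.09464, Thm. 1.3 and §3.
  [ChaeWolf2017RemovingDSS]
-/

noncomputable section

namespace Summit.NavierStokesRegularity.NavierStokesRegularity.Theorems

open MeasureTheory Set Function Filter Metric Real
open scoped Topology ContDiff
open Literature.Analysis.FluidPDE Literature.Analysis.FluidPDE.PineauVicol2026

/-! ### From the profile bound to the Type-I bound on all of `t < 0` -/

/-- Remark 1.2 on all of `t < 0`: if the (possibly `s`-dependent) profile obeys
`‖U(y,s)‖ ≤ C₀/(1+‖y‖)` for ALL `y, s`, then the ansatz field (1.13a) obeys the Type-I bound with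
constant `C₀` at every `t < 0` (the tree's `typeI_of_norm_profile_le` restricted to `s ≥ 0`,
i.e. `t ∈ [−1,0)`; here for periodic profiles, where (1.9) holds for every `s`). [cite: PineauVicol2026, Remark 1.2 (pp. 3–4) and Lemma 7.1 (p. 24)] -/
private theorem rdssCompact_hasTypeIDecay_of_profile {C₀ α : ℝ}
    {U : EuclideanSpace ℝ (Fin 3) → ℝ → EuclideanSpace ℝ (Fin 3)}
    (hU : ∀ (y : EuclideanSpace ℝ (Fin 3)) (s : ℝ), ‖U y s‖ ≤ C₀ / (1 + ‖y‖)) :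
    HasTypeIDecay C₀ (pvAnsatz α U) := by
  intro t ht x
  have hr : 0 < Real.sqrt (-t) := Real.sqrt_pos.2 (by linarith)
  rw [norm_pvAnsatz]
  have hy := hU (rotZ (-(α * -Real.log (-t))) ((Real.sqrt (-t))⁻¹ • x)) (-Real.log (-t))
  rw [norm_rotZ, norm_smul, norm_inv, Real.norm_of_nonneg hr.le] at hy
  calc (Real.sqrt (-t))⁻¹ *
        ‖U (rotZ (-(α * -Real.log (-t))) ((Real.sqrt (-t))⁻¹ • x)) (-Real.log (-t))‖
      ≤ (Real.sqrt (-t))⁻¹ * (C₀ / (1 + (Real.sqrt (-t))⁻¹ * ‖x‖)) :=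
        mul_le_mul_of_nonneg_left hy (inv_nonneg.2 hr.le)
    _ = C₀ / (‖x‖ + Real.sqrt (-t)) := by
        field_simp
        ring

/-- A profile slice which does not vanish makes the ansatz field non-zero somewhere at a negative
time: `U(y, s) ≠ 0` gives `u(−e^{−s}, √(e^{−s}) R(αs) y) ≠ 0` (the size identity
`√(−t)|u(x,t)| = |U(y,s)|`). [cite: PineauVicol2026, proof of Lemma 7.1 (p. 24)] -/
private theorem rdssCompact_field_ne_zero_of_profile {α : ℝ}
    {U : EuclideanSpace ℝ (Fin 3) → ℝ → EuclideanSpace ℝ (Fin 3)}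
    {y : EuclideanSpace ℝ (Fin 3)} {s : ℝ} (h : U y s ≠ 0) :
    ∃ t < 0, ∃ x : EuclideanSpace ℝ (Fin 3), pvAnsatz α U t x ≠ 0 := by
  set t : ℝ := -Real.exp (-s) with ht
  have ht0 : t < 0 := by have := Real.exp_pos (-s); linarith
  have hlog : -Real.log (-t) = s := by rw [ht, neg_neg, Real.log_exp, neg_neg]
  have hr : 0 < Real.sqrt (-t) := Real.sqrt_pos.2 (by linarith)
  refine ⟨t, ht0, Real.sqrt (-t) • rotZ (α * s) y, fun hzero => h ?_⟩
  have hn := congrArg (fun v : EuclideanSpace ℝ (Fin 3) => ‖v‖) hzero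
  simp only [norm_zero] at hn
  rw [norm_pvAnsatz, hlog, inv_smul_smul₀ hr.ne', ← rotZ_add, neg_add_cancel, rotZ_zero,
    mul_eq_zero] at hn
  rcases hn with hn | hn
  · exact absurd hn (inv_ne_zero hr.ne')
  · exact norm_eq_zero.1 hn

/-! ### The registered sub-goal -/

/-- **RDSS Liouville near `(α₀, λ = 1)` from RSS Liouville at `α₀` (registered sub-goal
`rdssCompact_liouville_near`).** For `C₀ > 0` and a speed `α₀` at which every Type-I (constant
`C₀`) rotated self-similar classical solution of Pineau–Vicol's class is trivial, there are `δ > 0`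
and `c₁ > 1` such that every classical solution on `[−1,0)` with the Type-I bound (constant `C₀`)
which is backwards rotated discretely self-similar with speed `α`, `|α − α₀| < δ`, factor
`c ∈ (1, c₁)` and a `C²` profile of period `2 log c`, has `U ≡ 0` on `ℝ³ × [0, 2 log c]`. New for
`α₀ ≠ 0`; for `α₀ = 0` it is Theorem 1.7 (i) of the source (`rdssCompact_pineauVicol_thm17_small`). [cite: PineauVicol2026, Theorem 1.7 (arXiv:2607.09619 p. 7) and p. 6; ChaeWolf2017RemovingDSS, §3] -/
theorem rdssCompact_liouville_near :
    ∀ (C₀ : ℝ), 0 < C₀ → ∀ (α₀ : ℝ), (∀ (u : ℝ → EuclideanSpace ℝ (Fin 3) → EuclideanSpace ℝ (Fin 3)) (p : ℝ → EuclideanSpace ℝ (Fin 3) → ℝ) (U : EuclideanSpace ℝ (Fin 3) → EuclideanSpace ℝ (Fin 3)), Literature.Analysis.FluidPDE.IsClassicalNSSolutionOn (Set.Ico (-1) 0) 1 0 u p → (∀ t ∈ Set.Ico (-1 : ℝ) 0, ∀ x : EuclideanSpace ℝ (Fin 3), ‖u t x‖ ≤ C₀ / (‖x‖ + Real.sqrt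 (-t))) → ContDiff ℝ 2 U → (∀ t ∈ Set.Ico (-1 : ℝ) 0, ∀ x : EuclideanSpace ℝ (Fin 3), u t x = Literature.Analysis.FluidPDE.pvAnsatz α₀ (fun y _ => U y) t x) → U = 0) → ∃ δ : ℝ, 0 < δ ∧ ∃ c₁ : ℝ, 1 < c₁ ∧ ∀ (α c : ℝ) (u : ℝ → EuclideanSpace ℝ (Fin 3) → EuclideanSpace ℝ (Fin 3)) (p : ℝ → EuclideanSpace ℝ (Fin 3) → ℝ) (U : EuclideanSpace ℝ (Fin 3) → ℝ → EuclideanSpace ℝ (Fin 3)), |α - α₀| < δ → 1 < c → c < c₁ → Literature.Analysis.FluidPDE.IsClassicalNSSolutionOn (Set.Ico (-1) 0) 1 0 u p → (∀ t ∈ Set.Ico (-1 : ℝ) 0, ∀ x : EuclideanSpace ℝ (Fin 3), ‖u t x‖ ≤ C₀ / (‖x‖ + Real.sqrt (-t))) → ContDiff ℝ 2 (fun q : EuclideanSpace ℝ (Fin 3) × ℝ => U q.1 q.2) → (∀ (y : EuclideanSpace ℝ (Fin 3)) (s : ℝ), U y (s + 2 * Real.log c) = U y s) → (∀ t ∈ Set.Ico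 (-1 : ℝ) 0, ∀ x : EuclideanSpace ℝ (Fin 3), u t x = Literature.Analysis.FluidPDE.pvAnsatz α U t x) → ∀ (y : EuclideanSpace ℝ (Fin 3)), ∀ s ∈ Set.Icc (0 : ℝ) (2 * Real.log c), U y s = 0 := by
  intro C₀ hC₀ α₀ hL
  by_contra H
  push Not at H
  -- counterexamples with `|α_n - α₀| < 1/(n+1)` and `1 < c_n < 1 + 1/(n+1)`
  have hpos : ∀ n : ℕ, (0 : ℝ) < 1 / ((n : ℝ) + 1) := fun n => by positivity
  choose α c u p U hαd hc1 hc2 hsol hI _hU2 hper hans y s hs hne using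
    fun n : ℕ => H (1 / ((n : ℝ) + 1)) (hpos n) (1 + 1 / ((n : ℝ) + 1)) (by linarith [hpos n])
  -- backward extensions with the same Type-I constant
  have hc0 : ∀ n, 0 < c n := fun n => by linarith [hc1 n]
  have hext : ∀ n, ∃ P : ℝ → EuclideanSpace ℝ (Fin 3) → ℝ,
      IsClassicalNSSolutionOn (Iio 0) 1 0 (pvAnsatz (α n) (U n)) P := fun n =>
    exists_isClassicalNSSolutionOn_Iio_of_isRotatedDSS (hsol n) (hc1 n)
      (isRotatedDSS_pvAnsatz (α := α n) (hc0 n) (hper n)) (hans n)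
  choose P hP using hext
  have hIw : ∀ n, HasTypeIDecay C₀ (pvAnsatz (α n) (U n)) := fun n =>
    rdssCompact_hasTypeIDecay_of_profile (norm_profile_le_of_typeI_periodic (hc1 n) (hI n) (hper n)
      (hans n))
  have hnt : ∀ n, ∃ t < 0, ∃ x : EuclideanSpace ℝ (Fin 3), pvAnsatz (α n) (U n) t x ≠ 0 := fun n =>
    rdssCompact_field_ne_zero_of_profile (hne n)
  -- `c n → 1`, `α n → α₀`
  have hclim : Tendsto c atTop (𝓝 1) := by
    have h0 : Tendsto (fun n : ℕ => (1 : ℝ) + 1 / ((n : ℝ) + 1)) atTop (𝓝 (1 + 0)) :=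
      tendsto_const_nhds.add tendsto_one_div_add_atTop_nhds_zero_nat
    rw [add_zero] at h0
    exact tendsto_of_tendsto_of_tendsto_of_le_of_le tendsto_const_nhds h0
      (fun n => (hc1 n).le) (fun n => (hc2 n).le)
  have hαlim : Tendsto α atTop (𝓝 α₀) := by
    rw [tendsto_iff_norm_sub_tendsto_zero]
    exact squeeze_zero (fun n => norm_nonneg _) (fun n => by
      rw [Real.norm_eq_abs]; exact (hαd n).le) tendsto_one_div_add_atTop_nhds_zero_nat
  obtain ⟨v, hvc, hvI, hweak, hss, x, hx⟩ := rdssCompact_exists_limit C₀ α₀ α c U P hC₀ hc1 hclim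
    hαlim hper hP hIw hnt
  exact rssCompact_not_liouvilleAt_of_limit hvc hvI hweak hss ⟨x, hx⟩ hL

/-! ### Pineau–Vicol 2026, Theorem 1.7 (i), and neighbourhoods of the extreme regimes -/

/-- **Pineau–Vicol 2026, Theorem 1.7 (i) (RDSS Liouville for `|α| ≤ α₁`, `1 < c < c₁`), by
compactness** — exactly the first conjunct of the named fact
`Literature.Analysis.FluidPDE.pineauVicol2026_rdss_liouville`: the speed `α₀ = 0` is good
(Theorem 1.4, `pineauVicol2026_rss_liouville_holds`), so `rdssCompact_liouville_near` applies. [cite: PineauVicol2026, Theorem 1.7 (i) (arXiv:2607.09619 p. 7)] -/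
theorem rdssCompact_pineauVicol_thm17_small (C₀ : ℝ) (hC₀ : 0 < C₀) :
    ∃ α₁ c₁ : ℝ, 0 < α₁ ∧ 1 < c₁ ∧
      ∀ (α c : ℝ) (u : ℝ → EuclideanSpace ℝ (Fin 3) → EuclideanSpace ℝ (Fin 3))
        (p : ℝ → EuclideanSpace ℝ (Fin 3) → ℝ)
        (U : EuclideanSpace ℝ (Fin 3) → ℝ → EuclideanSpace ℝ (Fin 3)),
        |α| ≤ α₁ → 1 < c → c < c₁ →
        IsClassicalNSSolutionOn (Ico (-1) 0) 1 0 u p →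
        (∀ t ∈ Ico (-1 : ℝ) 0, ∀ x : EuclideanSpace ℝ (Fin 3), ‖u t x‖ ≤ C₀ / (‖x‖ + Real.sqrt (-t))) →
        ContDiff ℝ 2 (fun q : EuclideanSpace ℝ (Fin 3) × ℝ => U q.1 q.2) →
        (∀ (y : EuclideanSpace ℝ (Fin 3)) (s : ℝ), U y (s + 2 * Real.log c) = U y s) →
        (∀ t ∈ Ico (-1 : ℝ) 0, ∀ x : EuclideanSpace ℝ (Fin 3), u t x = pvAnsatz α U t x) →
        ∀ (y : EuclideanSpace ℝ (Fin 3)), ∀ s ∈ Icc (0 : ℝ) (2 * Real.log c), U y s = 0 := by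
  -- `α₀ = 0` is a good speed
  obtain ⟨a₁, a₂, ha₁, -, hPV⟩ := pineauVicol2026_rss_liouville_holds C₀ hC₀
  have hL0 : ∀ (u : ℝ → EuclideanSpace ℝ (Fin 3) → EuclideanSpace ℝ (Fin 3))
      (p : ℝ → EuclideanSpace ℝ (Fin 3) → ℝ) (U : EuclideanSpace ℝ (Fin 3) → EuclideanSpace ℝ (Fin 3)),
      IsClassicalNSSolutionOn (Ico (-1) 0) 1 0 u p →
      (∀ t ∈ Ico (-1 : ℝ) 0, ∀ x : EuclideanSpace ℝ (Fin 3), ‖u t x‖ ≤ C₀ / (‖x‖ + Real.sqrt (-t))) →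
      ContDiff ℝ 2 U →
      (∀ t ∈ Ico (-1 : ℝ) 0, ∀ x : EuclideanSpace ℝ (Fin 3), u t x = pvAnsatz 0 (fun y _ => U y) t x) →
      U = 0 :=
    fun u p U h1 h2 h3 h4 => hPV 0 u p U h1 h2 h3 h4 (Or.inl (by simpa using ha₁))
  obtain ⟨δ, hδ, c₁, hc₁, hmain⟩ := rdssCompact_liouville_near C₀ hC₀ 0 hL0
  refine ⟨δ / 2, c₁, by positivity, hc₁, fun α c u p U hα hc hc' h1 h2 h3 h4 h5 => ?_⟩
  exact hmain α c u p U (by rw [sub_zero]; linarith [abs_nonneg α]) hc hc' h1 h2 h3 h4 h5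


/-- **RDSS Liouville for factors near `1` at every speed of the two regimes of Theorem 1.4.** For
`C₀ > 0` there are Pineau–Vicol's thresholds `α₁, α₂ > 0` such that near every speed `α₀` with
`|α₀| < α₁` or `|α₀| > α₂` (all good by Theorem 1.4), Type-I RDSS solutions with factor close to
`1` are trivial (`rdssCompact_liouville_near`). For `|α₀| > α₂` this is new relative to Theorem 1.7,
whose part (ii) constrains the factor by `c < c₂^{1/(1+α²)}` uniformly in `α`; here the factor
window depends on `α₀` (compactness, no uniformity). [cite: PineauVicol2026, Theorems 1.4 and 1.7 (arXiv:2607.09619 pp. 4, 7)] -/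
theorem rdssCompact_liouville_near_of_extreme (C₀ : ℝ) (hC₀ : 0 < C₀) :
    ∃ α₁ α₂ : ℝ, 0 < α₁ ∧ 0 < α₂ ∧ ∀ α₀ : ℝ, (|α₀| < α₁ ∨ α₂ < |α₀|) →
      ∃ δ : ℝ, 0 < δ ∧ ∃ c₁ : ℝ, 1 < c₁ ∧
        ∀ (α c : ℝ) (u : ℝ → EuclideanSpace ℝ (Fin 3) → EuclideanSpace ℝ (Fin 3))
          (p : ℝ → EuclideanSpace ℝ (Fin 3) → ℝ)
          (U : EuclideanSpace ℝ (Fin 3) → ℝ → EuclideanSpace ℝ (Fin 3)),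
          |α - α₀| < δ → 1 < c → c < c₁ →
          IsClassicalNSSolutionOn (Ico (-1) 0) 1 0 u p →
          (∀ t ∈ Ico (-1 : ℝ) 0, ∀ x : EuclideanSpace ℝ (Fin 3), ‖u t x‖ ≤ C₀ / (‖x‖ + Real.sqrt (-t))) →
          ContDiff ℝ 2 (fun q : EuclideanSpace ℝ (Fin 3) × ℝ => U q.1 q.2) →
          (∀ (y : EuclideanSpace ℝ (Fin 3)) (s : ℝ), U y (s + 2 * Real.log c) = U y s) →
          (∀ t ∈ Ico (-1 : ℝ) 0, ∀ x : EuclideanSpace ℝ (Fin 3), u t x = pvAnsatz α U t x) →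
          ∀ (y : EuclideanSpace ℝ (Fin 3)), ∀ s ∈ Icc (0 : ℝ) (2 * Real.log c), U y s = 0 := by
  obtain ⟨a₁, a₂, ha₁, ha₂, hPV⟩ := pineauVicol2026_rss_liouville_holds C₀ hC₀
  refine ⟨a₁, a₂, ha₁, ha₂, fun α₀ hα₀ => ?_⟩
  exact rdssCompact_liouville_near C₀ hC₀ α₀ fun u p U h1 h2 h3 h4 => hPV α₀ u p U h1 h2 h3 h4 hα₀

end Summit.NavierStokesRegularity.NavierStokesRegularity.Theorems

end
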